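import Literature.NumberTheory.EllipticCurves.BSDSelmerParityDokchitserProofs
import Literature.NumberTheory.EllipticCurves.BSDSelmerParityDokchitserBaseChangeProofs
import Literature.NumberTheory.EllipticCurves.LeadingTerm
import Literature.NumberTheory.EllipticCurves.LeadingTermProofs
import Literature.NumberTheory.EllipticCurves.PAdicBSD
import HarnessLib

/-!
# BirchSwinnertonDyer — crux `UBPotentiallyGood` (stmt-BirchSwinnertonDyer-15878), line `Sketch`,
# stub `stub_gzkRange`: the literature debt, itemised (conditional, sorry-free)

Stub `stub_gzkRange` of line `Sketch` (crux `ToricShedding.UBPotentiallyGood` =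
`FrozenTwin.UBPotentiallyGood` = `DefiniteTheta.UBPotentiallyGood`, the potentially-good sector of
the Selmer-rank upper bound) is the image-free GZK RANGE of `p^∞`-Selmer BSD,

  `∀ W elliptic, p prime, ord_{s=1} L(W,s) ≤ 1 → corank_{ℤ_p} Sel_{p^∞}(W/ℚ) = ord_{s=1} L(W,s)`,

a theorem in print — Gross–Zagier 1986 + Kolyvagin 1990 with modularity (Darmon, CBMS 101 (2004),
Thm. 3.22: `rank E(ℚ) = ord` and `Ш(E/ℚ)` finite), Greenberg's corank identity
`corank Sel_{p^∞} = rank + corank Ш[p^∞]` (LNM 1716, §1; tree THEOREM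
`selmerCorank_eq_mordellWeilRank_add_holds`), and at `ord = 0` Kato, Astérisque 295, Cor. 14.3 —
which the tree holds only behind the UNDISCHARGED named facts bsd.S17
`rank_eq_analyticRank_of_analyticRank_le_one` and bsd.S20 `kato_finite_of_L_one_ne_zero` (no
`_holds` for either; every in-tree reduction of bsd.S17 takes modularity, Gross–Zagier, Kolyvagin
and non-vanishing of twists as hypotheses). This file does NOT prove the stub and does not carry
its name; it records, with every named fact a HYPOTHESIS (never vendored), what the stub costs:

* `ubPotentiallyGood_stub_gzkRange_of_fact` — the stub ⇐ bsd.S17, one line over the tree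
  corollary `selmerCorank_eq_analyticRank_of_analyticRank_le_one`;
* cell `ord = 0` (`ubPotentiallyGood_gzkRange_rankZero_of_kato`): `corank = 0` ⇐ Kato Cor. 14.3 at
  `(W, p)` (it gives `Sel_{p^∞}(W/ℚ)` finite outright, so BOTH `rank = 0` and `Ш[p^∞]` finite are
  covered) + the entire continuation of `L(W,s)` (only to turn `ord = 0` into `L(W,1) ≠ 0`);
* cell `ord = 1` (`ubPotentiallyGood_gzkRange_rankOne_of_heegnerField`), SELMER-NATIVE over a
  Heegner field `K` with `L(W^{(d_K)},1) ≠ 0` (Waldspurger's form): Gross–Zagier–Kolyvagin over `K`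
  (`rank W(K) = 1`, `Ш(W/K)` finite) ⇒ `corank_p(W/K) = 1` (Greenberg over `K`) ⇒
  `corank_p(W) + corank_p(W^{(d_K)}) = 1` (PROVED quadratic additivity
  `selmerCorank_baseChange_quadratic_holds`) and `corank_p(W^{(d_K)}) = 0` by Kato for the twist —
  so neither the Gross–Zagier formula over `ℚ` nor Murty–Murty nor the descent of `Ш` is needed;
* `ubPotentiallyGood_gzkRange_of_isGloballyMinimal` — reduction to globally minimal models
  (proved invariances), and the assembly `ubPotentiallyGood_stub_gzkRange_of_kato_of_waldspurger`
  from exactly five named inputs: Kato bsd.S20, continuation, parity of `ord`, Waldspurger, GZK/`K`.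

References: Darmon 2004, Thm. 3.22 and §3.9; Kato 2004, Cor. 14.3; Gross 1991, (1.1) and Thm. 1.3;
Greenberg 1999, §1; Dokchitser–Dokchitser 2010, Lemma 4.14; Waldspurger 1985.
-/

-- D-0017: single-problem summit, so `Summit.BirchSwinnertonDyer.BirchSwinnertonDyer.…` repeats a
-- namespace BY DESIGN.
set_option linter.dupNamespace false

namespace Summit.BirchSwinnertonDyer.BirchSwinnertonDyer.Theorems

open Literature.NumberTheory.EllipticCurves WeierstrassCurve

/-- **Stub `stub_gzkRange` from bsd.S17** (Gross–Zagier–Kolyvagin; Darmon 2004, Thm. 3.22: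
`ord ≤ 1 ⇒ rank = ord ∧ Ш finite`, UNPROVED in the tree, hypothesis `h`): the registered statement
verbatim, by the tree corollary `selmerCorank_eq_analyticRank_of_analyticRank_le_one` (Greenberg's
identity and `corank Ш[p^∞] = 0` for finite `Ш`). CONDITIONAL on `h`. [cite: Darmon2004, Thm. 3.22] -/
theorem ubPotentiallyGood_stub_gzkRange_of_fact
    (h : Literature.NumberTheory.EllipticCurves.rank_eq_analyticRank_of_analyticRank_le_one) :
    ∀ (W : WeierstrassCurve ℚ) [W.IsElliptic] (p : ℕ) [Fact p.Prime],
      W.analyticRank ≤ 1 → W.selmerCorank p = W.analyticRank :=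
  fun W _ p _ h1 => selmerCorank_eq_analyticRank_of_analyticRank_le_one h W p h1

/-! ### Cell `ord = 0`: Kato's finiteness theorem + continuation (Heegner-free) -/

/-- **Cell `ord = 0` at one pair `(W, p)`.** Granting Kato's theorem at `(W, p)`
(`hK : kato_finite_of_L_one_ne_zero W p`, Kato 2004 Cor. 14.3: `L(W,1) ≠ 0 ⇒ W(ℚ)`, `Ш[p^∞]` and
`Sel_{p^∞}(W/ℚ)` finite) and an entire continuation of `L(W,s)` (`hE`, modularity):
`ord_{s=1} L(W,s) = 0 ⇒ L(W,1) ≠ 0` (`analyticRank_eq_zero_iff_holds`; needed — in the junk branch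
`ord = 0` but `L(W,1) = 0`) `⇒ Sel_{p^∞}` finite `⇒ corank = 0` (`zpCorank_eq_zero_of_finite`).
CONDITIONAL on `hK`, `hE`. [cite: Kato2004Asterisque, Cor. 14.3 (p. 235)] -/
theorem ubPotentiallyGood_gzkRange_rankZero_of_kato (W : WeierstrassCurve ℚ) [W.IsElliptic]
    (p : ℕ) [Fact p.Prime] (hK : kato_finite_of_L_one_ne_zero W p) (hE : W.HasEntireLFunction)
    (h0 : W.analyticRank = 0) : W.selmerCorank p = 0 := by
  haveI : Finite (selmerGroupPInfty W p) :=
    (hK ((W.analyticRank_eq_zero_iff_holds hE).mp h0)).2.2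
  exact zpCorank_eq_zero_of_finite (selmerGroupPInfty W p) p

/-! ### Cell `ord = 1`: Selmer-native descent from a Heegner field -/

/-- **Cell `ord = 1` on a globally minimal model, from a Heegner field in Waldspurger's form.**
Data: `W/ℚ` elliptic, globally minimal, `ord_{s=1} L(W,s) = 1`; an imaginary quadratic `K` with
the Heegner hypothesis for `N_W` and `L(W^{(d_K)},1) ≠ 0` (`hL`). Named inputs (hypotheses):
`hE` continuation of all `L(E,s)` (modularity; for `ord L(W/K) = ord L(W) + ord L(W^{(d_K)})`,
`analyticRankEK_eq_add_of`); `h₂` Gross–Zagier + Kolyvagin over `K`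
(`mordellWeilRank_eq_one_of_LDerivEK_ne_zero W K`: `L'(W/K,1) ≠ 0 ⇒ rank W(K) = 1 ∧ Ш(W/K)`
finite; Gross 1991 (1.1) + Thm. 1.3); `hKt` Kato Cor. 14.3 for the twist at `p`. Proof:
`ord L(W^{(d_K)}) = 0`, so `ord L(W/K) = 1`, `L'(W/K,1) ≠ 0`
(`LDerivEK_ne_zero_of_analyticRankEK_eq_one`), `rank W(K) = 1`, `Ш(W/K)` finite, hence
`corank_p(W/K) = 1 + 0` (Greenberg's identity over `K`, proved); the PROVED additivity
`corank_p(W/K) = corank_p(W) + corank_p(W^{(d_K)})` (`selmerCorank_baseChange_quadratic_holds`,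
Dokchitser–Dokchitser 2010 Lemma 4.14) and `corank_p(W^{(d_K)}) = 0` (Kato, `Sel_{p^∞}` of the
twist is finite) give `corank_p(W) = 1`. No Gross–Zagier formula over `ℚ`, no descent of `Ш`.
CONDITIONAL on `hE`, `h₂`, `hKt`. [cite: GrossLMS1991, (1.1) and Thm. 1.3] -/
theorem ubPotentiallyGood_gzkRange_rankOne_of_heegnerField (hE : hasEntireLFunction_rat)
    (W : WeierstrassCurve ℚ) [W.IsElliptic] [W.IsGloballyMinimal] (p : ℕ) [Fact p.Prime]
    (h1 : W.analyticRank = 1) (K : Type) [Field K] [NumberField K] (hKq : IsImaginaryQuadratic K)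
    (hH : SatisfiesHeegnerHypothesis (W.conductorNorm ℤ) K)
    (hL : (W.quadraticTwist (NumberField.discr K : ℚ)).entireLFunction 1 ≠ 0)
    (h₂ : mordellWeilRank_eq_one_of_LDerivEK_ne_zero W K)
    (hKt : kato_finite_of_L_one_ne_zero (W.quadraticTwist (NumberField.discr K : ℚ)) p) :
    W.selmerCorank p = 1 := by
  haveI : NeZero (W.conductorNorm ℤ) := ⟨(W.conductorNorm_pos_holds).ne'⟩
  have hd : (NumberField.discr K : ℚ) ≠ 0 := by exact_mod_cast NumberField.discr_ne_zero K
  haveI := W.isElliptic_quadraticTwist hd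
  -- the twist has analytic rank `0`, so `ord L(W/K) = 1` and `L'(W/K,1) ≠ 0`
  have htw : (W.quadraticTwist (NumberField.discr K : ℚ)).analyticRank = 0 := by
    unfold WeierstrassCurve.analyticRank analyticOrderNatAt
    rw [analyticOrderAt_eq_zero.2 (Or.inr hL)]
    rfl
  have hr : analyticRankEK W K = 1 := by rw [analyticRankEK_eq_add_of hE, h1, htw]
  -- Gross–Zagier–Kolyvagin over `K`, then Greenberg's identity over `K`
  obtain ⟨hrkK, hshaK⟩ := h₂ hKq hH (LDerivEK_ne_zero_of_analyticRankEK_eq_one W K hr)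
  haveI : (W.baseChange K).IsElliptic := by rw [baseChange]; infer_instance
  haveI : Finite (W.baseChange K).sha := hshaK
  have hcK : (W.baseChange K).selmerCorank p = 1 := by
    rw [(W.baseChange K).selmerCorank_eq_mordellWeilRank_add_holds p, hrkK,
      (W.baseChange K).shaCorank_eq_zero_of_finite p]
  -- quadratic additivity of Selmer coranks (proved) and Kato for the twist
  have hadd := selmerCorank_baseChange_quadratic_holds W K hKq.1 p
  haveI : Finite (selmerGroupPInfty (W.quadraticTwist (NumberField.discr K : ℚ)) p) := (hKt hL).2.2
  have htw0 : (W.quadraticTwist (NumberField.discr K : ℚ)).selmerCorank p = 0 :=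
    zpCorank_eq_zero_of_finite _ p
  omega

/-! ### Reduction to globally minimal models, and the assembly -/

/-- **The stub from its globally minimal case** (bookkeeping, proved): every elliptic `W/ℚ` has a
globally minimal model `C • W` (`hasGlobalMinimalModel_rat_holds`, Silverman AEC Cor. VIII.8.3),
and both sides are invariant under the change of variables — `analyticRank_variableChange_holds`,
`selmerCorank_eq_of_variableChange` (isomorphic curves have isomorphic `p^∞`-Selmer groups).
[cite: SilvermanAEC2009, Cor. VIII.8.3] -/
theorem ubPotentiallyGood_gzkRange_of_isGloballyMinimal
    (h : ∀ (W : WeierstrassCurve ℚ) [W.IsElliptic] [W.IsGloballyMinimal] (p : ℕ) [Fact p.Prime],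
      W.analyticRank ≤ 1 → W.selmerCorank p = W.analyticRank)
    (W : WeierstrassCurve ℚ) [W.IsElliptic] (p : ℕ) [Fact p.Prime] (hle : W.analyticRank ≤ 1) :
    W.selmerCorank p = W.analyticRank := by
  obtain ⟨C, hC⟩ := hasGlobalMinimalModel_rat_holds W
  haveI := hC
  have han : (C • W).analyticRank = W.analyticRank := analyticRank_variableChange_holds W C
  rw [selmerCorank_eq_of_variableChange p (rfl : C • W = C • W), ← han]
  exact h (C • W) p (by rwa [han])

/-- **Stub `stub_gzkRange` from five primary named inputs** (all hypotheses, UNPROVED in the tree):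
`hKato` Kato 2004 Cor. 14.3 (bsd.S20, every elliptic curve and prime); `hE` the entire
continuation of `L(E,s)` (`hasEntireLFunction_rat`, modularity); `hpar` parity of the analytic
rank (`even_analyticRank_iff`: `ord` even iff `w = +1`, from the functional equation); `hWa`
Waldspurger 1985 (`waldspurger_exists_heegnerField_twist_ne_zero`: for `w(E) = -1` a Heegner field
`K` with `L(E^{(d_K)},1) ≠ 0`); `h₂` Gross–Zagier + Kolyvagin over `K`. Cell `ord = 0` is
`ubPotentiallyGood_gzkRange_rankZero_of_kato`; cell `ord = 1` on minimal models: `ord` odd forces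
`w(W) = -1` (`hpar`), `hWa` supplies `K`, then `ubPotentiallyGood_gzkRange_rankOne_of_heegnerField`;
general `W` by `ubPotentiallyGood_gzkRange_of_isGloballyMinimal`. Neither the Gross–Zagier formula
over `ℚ` nor the Murty–Murty simple-zero twist (both inputs of the tree's assembly of bsd.S17)
enters. CONDITIONAL on the five inputs. [cite: Darmon2004, Thm. 3.22 and §3.9] -/
theorem ubPotentiallyGood_stub_gzkRange_of_kato_of_waldspurger
    (hKato : ∀ (W : WeierstrassCurve ℚ) [W.IsElliptic] (p : ℕ) [Fact p.Prime],
      kato_finite_of_L_one_ne_zero W p)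
    (hE : hasEntireLFunction_rat) (hpar : ∀ W : WeierstrassCurve ℚ, W.even_analyticRank_iff)
    (hWa : waldspurger_exists_heegnerField_twist_ne_zero)
    (h₂ : ∀ (W : WeierstrassCurve ℚ) (K : Type) [Field K] [NumberField K],
      mordellWeilRank_eq_one_of_LDerivEK_ne_zero W K) :
    ∀ (W : WeierstrassCurve ℚ) [W.IsElliptic] (p : ℕ) [Fact p.Prime],
      W.analyticRank ≤ 1 → W.selmerCorank p = W.analyticRank := by
  intro W _ p _ hle
  refine ubPotentiallyGood_gzkRange_of_isGloballyMinimal (fun W _ _ p _ hle => ?_) W p hle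
  rcases Nat.le_one_iff_eq_zero_or_eq_one.mp hle with h0 | h1
  · rw [h0, ubPotentiallyGood_gzkRange_rankZero_of_kato W p (hKato W p) (hE W) h0]
  · have hw : W.rootNumber = -1 := by
      rcases W.rootNumber_eq_one_or with hw | hw
      · exact absurd ((hpar W).mpr hw) (by rw [h1]; exact Nat.not_even_one)
      · exact hw
    obtain ⟨K, _, _, hKq, hH, hL⟩ := hWa.exists W hw
    have hd : (NumberField.discr K : ℚ) ≠ 0 := by exact_mod_cast NumberField.discr_ne_zero K
    haveI := W.isElliptic_quadraticTwist hd
    rw [h1]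
    exact ubPotentiallyGood_gzkRange_rankOne_of_heegnerField hE W p h1 K hKq hH hL (h₂ W K)
      (hKato _ p)

end Summit.BirchSwinnertonDyer.BirchSwinnertonDyer.Theorems
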